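import Summits.NavierStokesRegularity.FunctionalMining.NoGo.ProfileIntegrals
import Mathlib.Analysis.InnerProductSpace.Laplacian
import Mathlib.Analysis.InnerProductSpace.Trace
import Mathlib.MeasureTheory.Integral.Pi
import Mathlib.MeasureTheory.Measure.Haar.InnerProductSpace
import HarnessLib
import HarnessLib.Audit

/-!
# Separable calculus on `ℝ³`: derivatives, Laplacian, divergence and Fubini for tensor products

Search for candidate a priori estimates; no regularity claim. NS FUNCTIONAL MINING — NO-GO BRANCH
(pub-nsfunc-nogo); toolkit for the explicit Euclidean enstrophy-production witness
(`NoGo/EnstrophyBudgetWitness.lean`).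

For three smooth profiles `φ 0, φ 1, φ 2 : ℝ → ℝ` the *separable monomial*
`sep φ i j k (y) = φ₀⁽ⁱ⁾(y₀) φ₁⁽ʲ⁾(y₁) φ₂⁽ᵏ⁾(y₂)` on `ℝ³ = EuclideanSpace ℝ (Fin 3)` has
`D(sep φ i j k)(y)[v] = v₀ sep φ (i+1) j k + v₁ sep φ i (j+1) k + v₂ sep φ i j (k+1)`
(`fderiv_sep_apply`) and `Δ (sep φ i j k) = sep φ (i+2) j k + sep φ i (j+2) k + sep φ i j (k+2)`
(`laplacian_sep`, Mathlib's `InnerProductSpace.laplacian`).  For a vector field assembled from three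
scalar components (`vec3`) the directional derivative, the Laplacian and the trace of the derivative
(the divergence) are computed componentwise (`fderiv_vec3_apply`, `laplacian_vec3_apply`,
`trace_fderiv_vec3`), and `∫_{ℝ³} F(y₀)G(y₁)H(y₂) dy = (∫F)(∫G)(∫H)` (`integral_sep3`, Fubini, no
integrability hypothesis).  One-dimensional facts live in `NoGo/ProfileIntegrals.lean`.  All
statements are folklore calculus; nothing is asserted about Navier–Stokes.
-/

open MeasureTheory Set Function
open scoped ContDiff Laplacian InnerProductSpace RealInnerProductSpace

namespace Summit.NavierStokesRegularity.FunctionalMining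

/-- `ℝ³` as a Euclidean space. [folklore] -/
abbrev E3 : Type := EuclideanSpace ℝ (Fin 3)

namespace Sep3

/-- `2 ≤ ∞` in `WithTop ℕ∞` (smoothness-order bookkeeping). [folklore] -/
private theorem two_le_infty : (2 : WithTop ℕ∞) ≤ ∞ := by
  change ((2 : ℕ∞) : WithTop ℕ∞) ≤ ((⊤ : ℕ∞) : WithTop ℕ∞)
  exact_mod_cast (le_top : (2 : ℕ∞) ≤ ⊤)

/-! ## Separable monomials on `ℝ³` -/

section Sep

variable (φ : Fin 3 → ℝ → ℝ)

/-- The separable monomial `sep φ i j k (y) = φ₀⁽ⁱ⁾(y₀) · φ₁⁽ʲ⁾(y₁) · φ₂⁽ᵏ⁾(y₂)`. [folklore] -/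
noncomputable def sep (i j k : ℕ) (y : E3) : ℝ :=
  iteratedDeriv i (φ 0) (y 0) * iteratedDeriv j (φ 1) (y 1) * iteratedDeriv k (φ 2) (y 2)

/-- The derivative of `sep φ i j k` at `y`, as a continuous linear form. [folklore] -/
noncomputable def sepD (i j k : ℕ) (y : E3) : E3 →L[ℝ] ℝ :=
  sep φ (i + 1) j k y • EuclideanSpace.proj 0 + sep φ i (j + 1) k y • EuclideanSpace.proj 1 +
    sep φ i j (k + 1) y • EuclideanSpace.proj 2

/-- `sepD φ i j k y v` in coordinates. [folklore] -/
theorem sepD_apply (i j k : ℕ) (y v : E3) :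
    sepD φ i j k y v =
      v 0 * sep φ (i + 1) j k y + v 1 * sep φ i (j + 1) k y + v 2 * sep φ i j (k + 1) y := by
  simp only [sepD, add_apply, smul_apply, smul_eq_mul]
  rw [show (EuclideanSpace.proj 0 : E3 →L[ℝ] ℝ) v = v 0 from rfl,
    show (EuclideanSpace.proj 1 : E3 →L[ℝ] ℝ) v = v 1 from rfl,
    show (EuclideanSpace.proj 2 : E3 →L[ℝ] ℝ) v = v 2 from rfl]
  ring

variable {φ}

/-- Chain rule for one coordinate: `y ↦ ψ⁽ᵏ⁾(y_a)`. [folklore] -/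
theorem hasFDerivAt_coord {ψ : ℝ → ℝ} (hψ : ContDiff ℝ ∞ ψ) (k : ℕ) (a : Fin 3) (y : E3) :
    HasFDerivAt (fun z : E3 => iteratedDeriv k ψ (z a))
      (iteratedDeriv (k + 1) ψ (y a) • (EuclideanSpace.proj a : E3 →L[ℝ] ℝ)) y := by
  have hh : HasDerivAt (iteratedDeriv k ψ) (iteratedDeriv (k + 1) ψ (y a)) (y a) :=
    hasDerivAt_iteratedDeriv hψ k (y a)
  have h := hh.comp_hasFDerivAt y (EuclideanSpace.proj a : E3 →L[ℝ] ℝ).hasFDerivAt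
  exact h

/-- The derivative of a separable monomial (product and chain rule). [folklore] -/
theorem hasFDerivAt_sep (hφ : ∀ a, ContDiff ℝ ∞ (φ a)) (i j k : ℕ) (y : E3) :
    HasFDerivAt (sep φ i j k) (sepD φ i j k y) y := by
  have h0 := hasFDerivAt_coord (hφ 0) i 0 y
  have h1 := hasFDerivAt_coord (hφ 1) j 1 y
  have h2 := hasFDerivAt_coord (hφ 2) k 2 y
  have h := (h0.mul h1).mul h2
  refine (h.congr_fderiv ?_)
  ext v
  simp only [sepD_apply, sep, add_apply,
    smul_apply, smul_eq_mul, Pi.mul_apply]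
  rw [show (EuclideanSpace.proj 0 : E3 →L[ℝ] ℝ) v = v 0 from rfl,
    show (EuclideanSpace.proj 1 : E3 →L[ℝ] ℝ) v = v 1 from rfl,
    show (EuclideanSpace.proj 2 : E3 →L[ℝ] ℝ) v = v 2 from rfl]
  ring

/-- `D(sep φ i j k)(y)[v] = v₀ sep φ (i+1) j k + v₁ sep φ i (j+1) k + v₂ sep φ i j (k+1)`. [folklore] -/
theorem fderiv_sep_apply (hφ : ∀ a, ContDiff ℝ ∞ (φ a)) (i j k : ℕ) (y v : E3) :
    fderiv ℝ (sep φ i j k) y v =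
      v 0 * sep φ (i + 1) j k y + v 1 * sep φ i (j + 1) k y + v 2 * sep φ i j (k + 1) y := by
  rw [(hasFDerivAt_sep hφ i j k y).fderiv, sepD_apply]

/-- `D(sep φ i j k) = sepD φ i j k` as functions. [folklore] -/
theorem fderiv_sep (hφ : ∀ a, ContDiff ℝ ∞ (φ a)) (i j k : ℕ) :
    fderiv ℝ (sep φ i j k) = fun y => sepD φ i j k y :=
  funext fun y => (hasFDerivAt_sep hφ i j k y).fderiv

/-- Separable monomials are differentiable. [folklore] -/
theorem differentiable_sep (hφ : ∀ a, ContDiff ℝ ∞ (φ a)) (i j k : ℕ) :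
    Differentiable ℝ (sep φ i j k) := fun y => (hasFDerivAt_sep hφ i j k y).differentiableAt

/-- Separable monomials are smooth. [folklore] -/
theorem contDiff_sep (hφ : ∀ a, ContDiff ℝ ∞ (φ a)) (i j k : ℕ) : ContDiff ℝ ∞ (sep φ i j k) := by
  have hc : ∀ (a : Fin 3) (m : ℕ), ContDiff ℝ ∞ (fun z : E3 => iteratedDeriv m (φ a) (z a)) :=
    fun a m => (contDiff_iteratedDeriv (hφ a) m).comp (EuclideanSpace.proj a : E3 →L[ℝ] ℝ).contDiff
  exact ((hc 0 i).mul (hc 1 j)).mul (hc 2 k)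

/-- Separable monomials are continuous. [folklore] -/
theorem continuous_sep (hφ : ∀ a, ContDiff ℝ ∞ (φ a)) (i j k : ℕ) : Continuous (sep φ i j k) :=
  (contDiff_sep hφ i j k).continuous

/-- The derivative `y ↦ sepD φ i j k y` of a separable monomial is itself differentiable, with the
expected derivative. [folklore] -/
theorem hasFDerivAt_sepD (hφ : ∀ a, ContDiff ℝ ∞ (φ a)) (i j k : ℕ) (y : E3) :
    HasFDerivAt (fun z => sepD φ i j k z)
      ((sepD φ (i + 1) j k y).smulRight (EuclideanSpace.proj 0 : E3 →L[ℝ] ℝ) +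
        (sepD φ i (j + 1) k y).smulRight (EuclideanSpace.proj 1 : E3 →L[ℝ] ℝ) +
        (sepD φ i j (k + 1) y).smulRight (EuclideanSpace.proj 2 : E3 →L[ℝ] ℝ)) y := by
  show HasFDerivAt (fun z => sep φ (i + 1) j k z • (EuclideanSpace.proj 0 : E3 →L[ℝ] ℝ) +
      sep φ i (j + 1) k z • (EuclideanSpace.proj 1 : E3 →L[ℝ] ℝ) +
      sep φ i j (k + 1) z • (EuclideanSpace.proj 2 : E3 →L[ℝ] ℝ)) _ y
  have hA := (hasFDerivAt_sep hφ (i + 1) j k y).smul_const (EuclideanSpace.proj 0 : E3 →L[ℝ] ℝ)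
  have hB := (hasFDerivAt_sep hφ i (j + 1) k y).smul_const (EuclideanSpace.proj 1 : E3 →L[ℝ] ℝ)
  have hC := (hasFDerivAt_sep hφ i j (k + 1) y).smul_const (EuclideanSpace.proj 2 : E3 →L[ℝ] ℝ)
  exact (hA.add hB).add hC

/-- `Δ (sep φ i j k) = sep φ (i+2) j k + sep φ i (j+2) k + sep φ i j (k+2)`. [folklore] -/
theorem laplacian_sep (hφ : ∀ a, ContDiff ℝ ∞ (φ a)) (i j k : ℕ) (y : E3) :
    Δ (sep φ i j k) y = sep φ (i + 2) j k y + sep φ i (j + 2) k y + sep φ i j (k + 2) y := by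
  rw [InnerProductSpace.laplacian_eq_iteratedFDeriv_orthonormalBasis (sep φ i j k)
    (EuclideanSpace.basisFun (Fin 3) ℝ)]
  simp only [iteratedFDeriv_two_apply, Fin.sum_univ_three, Matrix.cons_val_zero, Matrix.cons_val_one,
    fderiv_sep hφ]
  rw [(hasFDerivAt_sepD hφ i j k y).fderiv]
  simp only [add_apply, ContinuousLinearMap.smulRight_apply, sepD_apply,
    smul_apply, smul_eq_mul, EuclideanSpace.basisFun_apply]
  rw [show (EuclideanSpace.proj 0 : E3 →L[ℝ] ℝ) (EuclideanSpace.single 0 (1 : ℝ)) = 1 by simp,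
    show (EuclideanSpace.proj 1 : E3 →L[ℝ] ℝ) (EuclideanSpace.single 1 (1 : ℝ)) = 1 by simp,
    show (EuclideanSpace.proj 2 : E3 →L[ℝ] ℝ) (EuclideanSpace.single 2 (1 : ℝ)) = 1 by simp]
  simp

/-- If each profile vanishes for `2 < |t|`, a separable monomial vanishes as soon as one coordinate
has modulus `> 2`. [folklore] -/
theorem sep_eq_zero (h0 : ∀ a t, 2 < |t| → φ a t = 0) (i j k : ℕ) {y : E3} {a : Fin 3}
    (ha : 2 < |y a|) : sep φ i j k y = 0 := by
  unfold sep
  obtain rfl | rfl | rfl : a = 0 ∨ a = 1 ∨ a = 2 := by fin_cases a <;> simp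
  · rw [iteratedDeriv_eq_zero_of_abs_lt (h0 0) i _ ha]; ring
  · rw [iteratedDeriv_eq_zero_of_abs_lt (h0 1) j _ ha]; ring
  · rw [iteratedDeriv_eq_zero_of_abs_lt (h0 2) k _ ha]; ring

end Sep

/-! ## Points of `ℝ³` far from the origin have a large coordinate -/

/-- If `4 ≤ ‖y‖` in `ℝ³` then some coordinate satisfies `2 < |y a|`. [folklore] -/
theorem exists_two_lt_abs_coord {y : E3} (hy : 4 ≤ ‖y‖) : ∃ a : Fin 3, 2 < |y a| := by
  by_contra h
  push Not at h
  have hsq : ‖y‖ ^ 2 = ∑ a, ‖y a‖ ^ 2 := EuclideanSpace.norm_sq_eq y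
  have hle : ∑ a : Fin 3, ‖y a‖ ^ 2 ≤ 12 := by
    rw [Fin.sum_univ_three]
    have := h 0; have := h 1; have := h 2
    simp only [Real.norm_eq_abs]
    nlinarith [abs_nonneg (y 0), abs_nonneg (y 1), abs_nonneg (y 2)]
  nlinarith [norm_nonneg y]

/-! ## Vector fields from three scalar components -/

section Vec

variable (U : Fin 3 → E3 → ℝ)

/-- The vector field on `ℝ³` with scalar components `U 0, U 1, U 2`. [folklore] -/
noncomputable def vec3 : E3 → E3 := fun y => WithLp.toLp 2 fun i => U i y

/-- Components of `vec3 U`. [folklore] -/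
@[simp] theorem vec3_apply (y : E3) (i : Fin 3) : vec3 U y i = U i y := rfl

variable {U}

/-- `vec3 U` is `Cⁿ` when its components are. [folklore] -/
theorem contDiff_vec3 {n : WithTop ℕ∞} (hU : ∀ i, ContDiff ℝ n (U i)) : ContDiff ℝ n (vec3 U) :=
  contDiff_euclidean.2 fun i => by simpa using hU i

/-- `proj i ∘ vec3 U = U i`. [folklore] -/
private theorem proj_comp_vec3 (i : Fin 3) :
    (⇑(EuclideanSpace.proj i : E3 →L[ℝ] ℝ) ∘ vec3 U) = U i := by
  funext z; rfl

/-- Directional derivatives of `vec3 U` are computed componentwise. [folklore] -/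
theorem fderiv_vec3_apply (hU : ∀ i, Differentiable ℝ (U i)) (y v : E3) (i : Fin 3) :
    fderiv ℝ (vec3 U) y v i = fderiv ℝ (U i) y v := by
  have hd : DifferentiableAt ℝ (vec3 U) y :=
    differentiableAt_euclidean.2 fun j => by simpa using (hU j y)
  have h := ((EuclideanSpace.proj i : E3 →L[ℝ] ℝ).hasFDerivAt.comp y hd.hasFDerivAt).fderiv
  rw [proj_comp_vec3] at h
  rw [h]; rfl

/-- The Laplacian of `vec3 U` is computed componentwise. [folklore] -/
theorem laplacian_vec3_apply (hU : ∀ i, ContDiff ℝ 2 (U i)) (y : E3) (i : Fin 3) :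
    Δ (vec3 U) y i = Δ (U i) y := by
  have h2 : ContDiffAt ℝ 2 (vec3 U) y := (contDiff_vec3 hU).contDiffAt
  have h := h2.laplacian_CLM_comp_left (l := (EuclideanSpace.proj i : E3 →L[ℝ] ℝ))
  rw [proj_comp_vec3] at h
  rw [h]; rfl

/-- The divergence `tr D(vec3 U)(y) = ∂₀U₀ + ∂₁U₁ + ∂₂U₂`. [folklore] -/
theorem trace_fderiv_vec3 (hU : ∀ i, Differentiable ℝ (U i)) (y : E3) :
    LinearMap.trace ℝ E3 (fderiv ℝ (vec3 U) y : E3 →ₗ[ℝ] E3) =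
      fderiv ℝ (U 0) y (EuclideanSpace.single 0 1) + fderiv ℝ (U 1) y (EuclideanSpace.single 1 1) +
        fderiv ℝ (U 2) y (EuclideanSpace.single 2 1) := by
  rw [LinearMap.trace_eq_sum_inner _ (EuclideanSpace.basisFun (Fin 3) ℝ)]
  simp only [Fin.sum_univ_three, EuclideanSpace.basisFun_apply, ContinuousLinearMap.coe_coe,
    EuclideanSpace.inner_single_left, map_one, one_mul, fderiv_vec3_apply hU]

/-- `vec3 U` vanishes outside the ball of radius `4` if every component vanishes at points with a
coordinate of modulus `> 2`. [folklore] -/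
theorem vec3_eq_zero_of_norm (hU : ∀ i (y : E3) (a : Fin 3), 2 < |y a| → U i y = 0) (y : E3)
    (hy : 4 ≤ ‖y‖) : vec3 U y = 0 := by
  obtain ⟨a, ha⟩ := exists_two_lt_abs_coord hy
  ext i
  simp [hU i y a ha]

end Vec

/-! ## Fubini for tensor products on `ℝ³` -/

/-- `∫_{ℝ³} F(y₀) G(y₁) H(y₂) dy = (∫F)(∫G)(∫H)` (no integrability hypothesis: both sides use the
same junk value conventions, Mathlib `integral_fintype_prod_volume_eq_prod`). [folklore] -/
theorem integral_sep3 (F G H : ℝ → ℝ) :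
    ∫ y : E3, F (y 0) * G (y 1) * H (y 2) = (∫ t, F t) * (∫ t, G t) * (∫ t, H t) := by
  have h1 : ∫ y : E3, F (y 0) * G (y 1) * H (y 2) =
      ∫ x : Fin 3 → ℝ, F (x 0) * G (x 1) * H (x 2) := by
    have hme : MeasurableEmbedding (WithLp.toLp 2 : (Fin 3 → ℝ) → E3) :=
      (MeasurableEquiv.toLp 2 (Fin 3 → ℝ)).measurableEmbedding
    rw [← (PiLp.volume_preserving_toLp (Fin 3)).integral_comp hme
      (fun y : E3 => F (y 0) * G (y 1) * H (y 2))]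
  have h2 := MeasureTheory.integral_fintype_prod_volume_eq_prod (𝕜 := ℝ)
    (fun i : Fin 3 => (![F, G, H] : Fin 3 → ℝ → ℝ) i)
  simp only [Fin.prod_univ_three, Matrix.cons_val_zero, Matrix.cons_val_one, Matrix.head_cons,
    Matrix.cons_val_two, Matrix.tail_cons] at h2
  rw [h1, h2]

/-- A weighted finite list of integrable functions is integrable. [folklore] -/
theorem integrable_listSum {ι α : Type*} [MeasurableSpace α] {μ : Measure α} (c : ι → ℝ)
    (f : ι → α → ℝ) : ∀ (L : List ι), (∀ i ∈ L, Integrable (f i) μ) →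
      Integrable (fun x => (L.map fun i => c i * f i x).sum) μ
  | [], _ => by simp
  | i :: L, hL => by
      have hi : Integrable (fun x => c i * f i x) μ := (hL i (by simp)).const_mul (c i)
      have hr := integrable_listSum c f L (fun q hq => hL q (List.mem_cons_of_mem _ hq))
      simpa [List.map_cons, List.sum_cons, Pi.add_def] using hi.add hr

/-- A weighted finite list of functions integrates termwise when every entry is integrable. [folklore] -/
theorem integral_listSum {ι α : Type*} [MeasurableSpace α] {μ : Measure α} (c : ι → ℝ)
    (f : ι → α → ℝ) : ∀ (L : List ι), (∀ i ∈ L, Integrable (f i) μ) →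
      ∫ x, (L.map fun i => c i * f i x).sum ∂μ = (L.map fun i => c i * ∫ x, f i x ∂μ).sum
  | [], _ => by simp
  | i :: L, hL => by
      have hi : Integrable (fun x => c i * f i x) μ := (hL i (by simp)).const_mul (c i)
      have hL' : ∀ q ∈ L, Integrable (f q) μ := fun q hq => hL q (List.mem_cons_of_mem _ hq)
      have hr := integrable_listSum c f L hL'
      simp only [List.map_cons, List.sum_cons]
      rw [integral_add hi hr, integral_const_mul, integral_listSum c f L hL']

end Sep3

end Summit.NavierStokesRegularity.FunctionalMining
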